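import Summits.NavierStokesRegularity.TurbBounds.FSU1.Corner
import Summits.NavierStokesRegularity.TurbBounds.FSU1.Mode.M03Defs
import Summits.NavierStokesRegularity.TurbBounds.FSU1.Mode.M10MajorH

/-!
# FS-U1″ mode lemma — MajorJ (`TurbBounds/FSU1/Mode/M11MajorJ.lean`)

The even majorant `J(ρ) ≤ ρ⁴·PJ(ρ)` on `[0,1]` — `MJ.majorJ : MajorJ`.

Cell-made mathematics of FS-PROOF-DRAFT §3 (pub-turb-sos), kernel-checked; generated from the design compose file
`StageF_compose.check.lean` (96c4b9bf…) by `build_mode_split.py`.  HONEST FRAMING: rigorous bounds for the stated PDE and boundary conditions; no claim about physical turbulence beyond the bound.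
-/

open Real intervalIntegral MeasureTheory Set Finset

namespace Summit.NavierStokesRegularity.TurbBounds.FSU1.Mode

open Summit.NavierStokesRegularity.TurbBounds.SpectralFormFreeSlip
open Summit.NavierStokesRegularity.TurbBounds.FSU1

namespace MJ

open MH (c c_nonneg c_le fact_ge)

/-- Geometric tail of the coefficients: `c ρ (m+12) ≤ (ρ²⁴/26!)·(1/2)^m`. -/
theorem c_tail {ρ : ℝ} (hρ0 : 0 ≤ ρ) (hρ1 : ρ ≤ 1) (m : ℕ) :
    c ρ (m + 12) ≤ ρ ^ 24 / (Nat.factorial 26 : ℝ) * (1 / 2) ^ m := by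
  have hF : (Nat.factorial 26 : ℝ) * 2 ^ m ≤ ((2 * (m + 12) + 2).factorial : ℝ) := by
    exact_mod_cast fact_ge m
  calc c ρ (m + 12) = ρ ^ (2 * m) * ρ ^ 24 / ((2 * (m + 12) + 2).factorial : ℝ) := by
        unfold c; rw [show 2 * (m + 12) = 2 * m + 24 by ring, pow_add]
    _ ≤ 1 * ρ ^ 24 / ((2 * (m + 12) + 2).factorial : ℝ) := by
        gcongr; exact pow_le_one₀ hρ0 hρ1
    _ ≤ ρ ^ 24 / ((Nat.factorial 26 : ℝ) * 2 ^ m) := by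
        rw [one_mul]; exact div_le_div_of_nonneg_left (by positivity) (by positivity) hF
    _ = ρ ^ 24 / (Nat.factorial 26 : ℝ) * (1 / 2) ^ m := by
        rw [one_div, inv_pow]; field_simp

/-- `w p L v = L^(2p+2) − v^(2p+2)`. -/
noncomputable def w (p : ℕ) (L v : ℝ) : ℝ := L ^ (2 * p + 2) - v ^ (2 * p + 2)

/-- `w p L v = L^{2p+2} − v^{2p+2} ≥ 0` for `0 ≤ v ≤ L`. -/
theorem w_nonneg {p : ℕ} {L v : ℝ} (hv0 : 0 ≤ v) (hvL : v ≤ L) : 0 ≤ w p L v :=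
  sub_nonneg.2 (pow_le_pow_left₀ hv0 hvL _)

/-- `w p L v ≤ 1` for `0 ≤ v ≤ L ≤ 1`. -/
theorem w_le_one {p : ℕ} {L v : ℝ} (hv0 : 0 ≤ v) (hvL : v ≤ L) (hL1 : L ≤ 1) : w p L v ≤ 1 := by
  unfold w
  have h1 : L ^ (2 * p + 2) ≤ 1 := pow_le_one₀ (hv0.trans hvL) hL1
  have h2 : 0 ≤ v ^ (2 * p + 2) := pow_nonneg hv0 _
  linarith

/-- Power series of the kernel `cosh(ρL) − cosh(ρv)` (shifted by one: constant terms cancel). -/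
theorem hasSum_K (ρ L v : ℝ) :
    HasSum (fun p => ρ ^ 2 * (c ρ p * w p L v)) (Real.cosh (ρ * L) - Real.cosh (ρ * v)) := by
  set f : ℕ → ℝ := fun n => (ρ * L) ^ (2 * n) / ((2 * n).factorial : ℝ)
      - (ρ * v) ^ (2 * n) / ((2 * n).factorial : ℝ) with hfdef
  have h1 : HasSum f (Real.cosh (ρ * L) - Real.cosh (ρ * v)) :=
    (Real.hasSum_cosh _).sub (Real.hasSum_cosh _)
  have h2 := (hasSum_nat_add_iff' 1).mpr h1
  have hf0 : ∑ i ∈ range 1, f i = 0 := by simp [hfdef]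
  rw [hf0, sub_zero] at h2
  have e : (fun n => f (n + 1)) = fun p => ρ ^ 2 * (c ρ p * w p L v) := by
    funext n
    simp only [hfdef]
    unfold c w
    have e1 : 2 * (n + 1) = 2 * n + 2 := by ring
    rw [e1, mul_pow, mul_pow, pow_add ρ (2 * n) 2]
    field_simp
  rw [e] at h2
  exact h2

/-- Two-sided truncation bound for the kernel. -/
theorem K_bounds {ρ L v : ℝ} (hρ0 : 0 ≤ ρ) (hρ1 : ρ ≤ 1) (hv0 : 0 ≤ v) (hvL : v ≤ L) (hL1 : L ≤ 1) :
    ρ ^ 2 * (∑ p ∈ range 12, c ρ p * w p L v) ≤ Real.cosh (ρ * L) - Real.cosh (ρ * v) ∧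
    Real.cosh (ρ * L) - Real.cosh (ρ * v)
      ≤ ρ ^ 2 * ((∑ p ∈ range 12, c ρ p * w p L v) + ρ ^ 24 / (Nat.factorial 26 : ℝ) * 2) := by
  have H := hasSum_K ρ L v
  have Ht := (hasSum_nat_add_iff' 12).mpr H
  rw [← Finset.mul_sum] at Ht
  have Hg : HasSum (fun p : ℕ => ρ ^ 2 * (ρ ^ 24 / (Nat.factorial 26 : ℝ) * ((1:ℝ) / 2) ^ p))
      (ρ ^ 2 * (ρ ^ 24 / (Nat.factorial 26 : ℝ) * 2)) := (hasSum_geometric_two.mul_left _).mul_left _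
  have pt_up : ∀ n : ℕ, ρ ^ 2 * (c ρ (n + 12) * w (n + 12) L v)
      ≤ ρ ^ 2 * (ρ ^ 24 / (Nat.factorial 26 : ℝ) * ((1:ℝ) / 2) ^ n) := fun n =>
    mul_le_mul_of_nonneg_left
      ((mul_le_of_le_one_right (c_nonneg hρ0 _) (w_le_one hv0 hvL hL1)).trans (c_tail hρ0 hρ1 n))
      (sq_nonneg ρ)
  have pt_lo : ∀ n : ℕ, (0:ℝ) ≤ ρ ^ 2 * (c ρ (n + 12) * w (n + 12) L v) := fun n =>
    mul_nonneg (sq_nonneg ρ) (mul_nonneg (c_nonneg hρ0 _) (w_nonneg hv0 hvL))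
  have up := hasSum_le pt_up Ht Hg
  have lo := hasSum_le pt_lo hasSum_zero Ht
  refine ⟨by linarith, ?_⟩
  rw [mul_add]; linarith

/-- Squared kernel bound. -/
theorem K_sq_le {ρ L v : ℝ} (hρ0 : 0 ≤ ρ) (hρ1 : ρ ≤ 1) (hv0 : 0 ≤ v) (hvL : v ≤ L) (hL1 : L ≤ 1) :
    (Real.cosh (ρ * L) - Real.cosh (ρ * v)) ^ 2
      ≤ ρ ^ 4 * ((∑ p ∈ range 12, c ρ p * w p L v) + ρ ^ 24 / (Nat.factorial 26 : ℝ) * 2) ^ 2 := by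
  obtain ⟨lo, up⟩ := K_bounds hρ0 hρ1 hv0 hvL hL1
  have hS : 0 ≤ ∑ p ∈ range 12, c ρ p * w p L v :=
    Finset.sum_nonneg (fun p _ => mul_nonneg (c_nonneg hρ0 _) (w_nonneg hv0 hvL))
  have h0 : 0 ≤ Real.cosh (ρ * L) - Real.cosh (ρ * v) := le_trans (by positivity) lo
  calc (Real.cosh (ρ * L) - Real.cosh (ρ * v)) ^ 2
      ≤ (ρ ^ 2 * ((∑ p ∈ range 12, c ρ p * w p L v) + ρ ^ 24 / (Nat.factorial 26 : ℝ) * 2)) ^ 2 :=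
        pow_le_pow_left₀ h0 up 2
    _ = _ := by ring

/-! ### Exact integration of the squared truncation -/

/-- The monomial `x ↦ K·xⁿ` is interval-integrable on any `[a, b]`. -/
theorem mono_ii (K : ℝ) (n : ℕ) (a b : ℝ) : IntervalIntegrable (fun x : ℝ => K * x ^ n) volume a b :=
  (by fun_prop : Continuous fun x : ℝ => K * x ^ n).intervalIntegrable a b

/-- `∫₀^L K·x^n = K·L^{n+1}/(n+1)`. -/
theorem mono_int (K L : ℝ) (n : ℕ) : ∫ x in (0:ℝ)..L, K * x ^ n = K * L ^ (n + 1) / (n + 1) := by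
  rw [intervalIntegral.integral_const_mul, integral_pow]
  simp
  ring

/-- `∫₀ᴸ (K − Σ cf_m s^(2m+2))² ds` in closed form. -/
theorem integral_sq_poly_L (K L : ℝ) (cf : ℕ → ℝ) (N : ℕ) :
    ∫ s in (0:ℝ)..L, (K - ∑ m ∈ range N, cf m * s ^ (2 * m + 2)) ^ 2
      = K ^ 2 * L - 2 * K * ∑ m ∈ range N, cf m * L ^ (2 * m + 3) / (2 * m + 3)
        + ∑ m ∈ range N, ∑ n ∈ range N, cf m * cf n * L ^ (2 * m + 2 * n + 5) / (2 * m + 2 * n + 5) := by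
  have expand : ∀ s : ℝ, (K - ∑ m ∈ range N, cf m * s ^ (2 * m + 2)) ^ 2
      = K ^ 2 - 2 * K * (∑ m ∈ range N, cf m * s ^ (2 * m + 2))
        + ∑ m ∈ range N, ∑ n ∈ range N, (cf m * cf n) * s ^ (2 * m + 2 * n + 4) := by
    intro s
    rw [sub_sq, sq (∑ m ∈ range N, cf m * s ^ (2 * m + 2)), Finset.sum_mul_sum]
    congr 1
    refine Finset.sum_congr rfl (fun m _ => Finset.sum_congr rfl (fun n _ => ?_))
    rw [show 2 * m + 2 * n + 4 = (2 * m + 2) + (2 * n + 2) by ring, pow_add]; ring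
  rw [intervalIntegral.integral_congr (fun s _ => expand s)]
  have iB : IntervalIntegrable (fun s : ℝ => ∑ m ∈ range N, cf m * s ^ (2 * m + 2)) volume 0 L :=
    (continuous_finsetSum _ (fun m _ => by fun_prop)).intervalIntegrable 0 L
  have hB : ∫ s in (0:ℝ)..L, (∑ m ∈ range N, cf m * s ^ (2 * m + 2))
      = ∑ m ∈ range N, cf m * L ^ (2 * m + 3) / (2 * m + 3) := by
    rw [intervalIntegral.integral_finsetSum (fun m _ => mono_ii _ _ _ _)]
    refine Finset.sum_congr rfl (fun m _ => ?_)
    rw [mono_int]; push_cast; ring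
  have hBB : ∫ s in (0:ℝ)..L, (∑ m ∈ range N, ∑ n ∈ range N, (cf m * cf n) * s ^ (2 * m + 2 * n + 4))
      = ∑ m ∈ range N, ∑ n ∈ range N, cf m * cf n * L ^ (2 * m + 2 * n + 5) / (2 * m + 2 * n + 5) := by
    rw [intervalIntegral.integral_finsetSum (fun m _ =>
      (continuous_finsetSum _ (fun n _ => by fun_prop)).intervalIntegrable 0 L)]
    refine Finset.sum_congr rfl (fun m _ => ?_)
    rw [intervalIntegral.integral_finsetSum (fun n _ => mono_ii _ _ _ _)]
    refine Finset.sum_congr rfl (fun n _ => ?_)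
    rw [mono_int]; push_cast; ring
  have iK : IntervalIntegrable (fun _ : ℝ => K ^ 2) volume 0 L := intervalIntegrable_const
  have iKB : IntervalIntegrable (fun s : ℝ => 2 * K * ∑ m ∈ range N, cf m * s ^ (2 * m + 2)) volume 0 L :=
    ((continuous_finsetSum _ (fun m _ => by fun_prop)).const_mul _ |>.intervalIntegrable 0 L)
  have iS : IntervalIntegrable
      (fun s : ℝ => ∑ m ∈ range N, ∑ n ∈ range N, (cf m * cf n) * s ^ (2 * m + 2 * n + 4)) volume 0 L :=
    (continuous_finsetSum _ (fun m _ => continuous_finsetSum _ (fun n _ => by fun_prop))).intervalIntegrable 0 L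
  rw [intervalIntegral.integral_add (iK.sub iKB) iS, intervalIntegral.integral_sub iK iKB,
    intervalIntegral.integral_const_mul, hB, hBB, intervalIntegral.integral_const]
  simp; ring

/-- The closed form of the inner (`u`-) integral as a function of `L = 1 − σ`. -/
noncomputable def clf (ρ t L : ℝ) : ℝ :=
  (t + ∑ p ∈ range 12, c ρ p * L ^ (2 * p + 2)) ^ 2
    - 2 * (t + ∑ p ∈ range 12, c ρ p * L ^ (2 * p + 2)) * (∑ p ∈ range 12, c ρ p * L ^ (2 * p + 3) / (2 * p + 3))
    + ∑ p ∈ range 12, ∑ q ∈ range 12, c ρ p * c ρ q * L ^ (2 * p + 2 * q + 5) / (2 * p + 2 * q + 5)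

/-- Continuity in `u` of the truncated inner integrand of `J` (degree-11 partial sum). -/
theorem cont_inner (ρ σ t : ℝ) :
    Continuous (fun u : ℝ => ((∑ p ∈ range 12, c ρ p * w p (1 - σ) (max σ u - σ)) + t) ^ 2) := by
  refine ((continuous_finsetSum _ (fun p _ => ?_)).add continuous_const).pow 2
  unfold w
  exact continuous_const.mul (continuous_const.sub (((continuous_const.max continuous_id).sub continuous_const).pow _))

/-- Inner integral: split at `u = σ`, substitute `v = u − σ` on the upper triangle. -/
theorem inner_closed {ρ σ : ℝ} (hσ0 : 0 ≤ σ) (hσ1 : σ ≤ 1) (t : ℝ) :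
    ∫ u in (0:ℝ)..1, ((∑ p ∈ range 12, c ρ p * w p (1 - σ) (max σ u - σ)) + t) ^ 2 = clf ρ t (1 - σ) := by
  have Fc := cont_inner ρ σ t
  rw [← intervalIntegral.integral_add_adjacent_intervals (Fc.intervalIntegrable 0 σ) (Fc.intervalIntegrable σ 1)]
  set L := 1 - σ with hL
  set P := t + ∑ p ∈ range 12, c ρ p * L ^ (2 * p + 2) with hP
  -- lower triangle: the integrand is the constant P²
  have e1 : EqOn (fun u : ℝ => ((∑ p ∈ range 12, c ρ p * w p L (max σ u - σ)) + t) ^ 2)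
      (fun _ => P ^ 2) (uIcc 0 σ) := by
    intro u hu
    rw [uIcc_of_le hσ0] at hu
    simp only
    rw [max_eq_left hu.2, sub_self, hP, add_comm]
    congr 2
    refine Finset.sum_congr rfl (fun p _ => ?_)
    unfold w
    rw [zero_pow (by omega), sub_zero]
  have p1 : ∫ u in (0:ℝ)..σ, ((∑ p ∈ range 12, c ρ p * w p L (max σ u - σ)) + t) ^ 2 = σ * P ^ 2 := by
    rw [intervalIntegral.integral_congr e1, intervalIntegral.integral_const]
    simp
  -- upper triangle
  have e2 : EqOn (fun u : ℝ => ((∑ p ∈ range 12, c ρ p * w p L (max σ u - σ)) + t) ^ 2)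
      (fun u => (P - ∑ p ∈ range 12, c ρ p * (u - σ) ^ (2 * p + 2)) ^ 2) (uIcc σ 1) := by
    intro u hu
    rw [uIcc_of_le hσ1] at hu
    simp only
    rw [max_eq_right hu.1, hP]
    congr 1
    simp only [w, mul_sub, Finset.sum_sub_distrib]
    ring
  have p2 : ∫ u in σ..1, ((∑ p ∈ range 12, c ρ p * w p L (max σ u - σ)) + t) ^ 2
      = P ^ 2 * L - 2 * P * ∑ m ∈ range 12, c ρ m * L ^ (2 * m + 3) / (2 * m + 3)
        + ∑ m ∈ range 12, ∑ n ∈ range 12, c ρ m * c ρ n * L ^ (2 * m + 2 * n + 5) / (2 * m + 2 * n + 5) := by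
    rw [intervalIntegral.integral_congr e2]
    have sub := intervalIntegral.integral_comp_sub_right (a := σ) (b := 1)
      (fun v => (P - ∑ p ∈ range 12, c ρ p * v ^ (2 * p + 2)) ^ 2) σ
    simp only [sub_self] at sub
    rw [sub, ← hL]
    exact integral_sq_poly_L P L (c ρ) 12
  rw [p1, p2]
  have hs : σ = 1 - L := by rw [hL]; ring
  rw [hs]
  unfold clf
  rw [← hP]
  ring

/-! ### The outer integral of the closed form -/

/-- Expansion of the closed form `clf ρ t L` into `t²`, the single sums over `p < 12` and the double sum over `p, q < 12`. -/
theorem clf_expand (ρ t L : ℝ) : clf ρ t L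
    = t ^ 2
      + ∑ p ∈ range 12, ((2 * t * c ρ p) * L ^ (2 * p + 2) - (2 * t * c ρ p / (2 * p + 3)) * L ^ (2 * p + 3))
      + ∑ p ∈ range 12, ∑ q ∈ range 12,
          ((c ρ p * c ρ q) * L ^ (2 * p + 2 * q + 4) - (2 * c ρ p * c ρ q / (2 * q + 3)) * L ^ (2 * p + 2 * q + 5)
            + (c ρ p * c ρ q / (2 * p + 2 * q + 5)) * L ^ (2 * p + 2 * q + 5)) := by
  have hS : ∑ p ∈ range 12, ((2 * t * c ρ p) * L ^ (2 * p + 2) - (2 * t * c ρ p / (2 * p + 3)) * L ^ (2 * p + 3))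
      = 2 * t * (∑ p ∈ range 12, c ρ p * L ^ (2 * p + 2))
        - 2 * t * (∑ p ∈ range 12, c ρ p * L ^ (2 * p + 3) / (2 * p + 3)) := by
    rw [Finset.mul_sum, Finset.mul_sum, ← Finset.sum_sub_distrib]
    refine Finset.sum_congr rfl (fun p _ => ?_); ring
  have hD : ∑ p ∈ range 12, ∑ q ∈ range 12,
          ((c ρ p * c ρ q) * L ^ (2 * p + 2 * q + 4) - (2 * c ρ p * c ρ q / (2 * q + 3)) * L ^ (2 * p + 2 * q + 5)
            + (c ρ p * c ρ q / (2 * p + 2 * q + 5)) * L ^ (2 * p + 2 * q + 5))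
      = (∑ p ∈ range 12, c ρ p * L ^ (2 * p + 2)) * (∑ p ∈ range 12, c ρ p * L ^ (2 * p + 2))
        - 2 * ((∑ p ∈ range 12, c ρ p * L ^ (2 * p + 2)) * (∑ p ∈ range 12, c ρ p * L ^ (2 * p + 3) / (2 * p + 3)))
        + ∑ p ∈ range 12, ∑ q ∈ range 12, c ρ p * c ρ q * L ^ (2 * p + 2 * q + 5) / (2 * p + 2 * q + 5) := by
    rw [Finset.sum_mul_sum, Finset.sum_mul_sum, Finset.mul_sum, ← Finset.sum_sub_distrib, ← Finset.sum_add_distrib]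
    refine Finset.sum_congr rfl (fun p _ => ?_)
    rw [Finset.mul_sum, ← Finset.sum_sub_distrib, ← Finset.sum_add_distrib]
    refine Finset.sum_congr rfl (fun q _ => ?_)
    rw [show 2 * p + 2 * q + 4 = (2 * p + 2) + (2 * q + 2) by ring,
      show 2 * p + 2 * q + 5 = (2 * p + 2) + (2 * q + 3) by ring, pow_add, pow_add]
    ring
  rw [hS, hD]
  unfold clf
  ring

/-- Closed form of `∫₀¹ clf ρ t L dL` as a finite sum over `p < 12`. -/
theorem integral_clf (ρ t : ℝ) : ∫ L in (0:ℝ)..1, clf ρ t L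
    = t ^ 2
      + ∑ p ∈ range 12, (2 * t * c ρ p / (2 * p + 3) - 2 * t * c ρ p / ((2 * p + 3) * (2 * p + 4)))
      + ∑ p ∈ range 12, ∑ q ∈ range 12,
          (c ρ p * c ρ q / (2 * p + 2 * q + 5) - 2 * c ρ p * c ρ q / ((2 * q + 3) * (2 * p + 2 * q + 6))
            + c ρ p * c ρ q / ((2 * p + 2 * q + 5) * (2 * p + 2 * q + 6))) := by
  rw [intervalIntegral.integral_congr (fun L _ => clf_expand ρ t L)]
  have iC : IntervalIntegrable (fun _ : ℝ => t ^ 2) volume 0 1 := intervalIntegrable_const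
  have iS : IntervalIntegrable (fun L : ℝ => ∑ p ∈ range 12,
      ((2 * t * c ρ p) * L ^ (2 * p + 2) - (2 * t * c ρ p / (2 * p + 3)) * L ^ (2 * p + 3))) volume 0 1 :=
    (continuous_finsetSum _ (fun p _ => by fun_prop)).intervalIntegrable 0 1
  have iD : IntervalIntegrable (fun L : ℝ => ∑ p ∈ range 12, ∑ q ∈ range 12,
      ((c ρ p * c ρ q) * L ^ (2 * p + 2 * q + 4) - (2 * c ρ p * c ρ q / (2 * q + 3)) * L ^ (2 * p + 2 * q + 5)
        + (c ρ p * c ρ q / (2 * p + 2 * q + 5)) * L ^ (2 * p + 2 * q + 5))) volume 0 1 :=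
    (continuous_finsetSum _ (fun p _ => continuous_finsetSum _ (fun q _ => by fun_prop))).intervalIntegrable 0 1
  have hSint : ∫ L in (0:ℝ)..1, ∑ p ∈ range 12,
      ((2 * t * c ρ p) * L ^ (2 * p + 2) - (2 * t * c ρ p / (2 * p + 3)) * L ^ (2 * p + 3))
      = ∑ p ∈ range 12, (2 * t * c ρ p / (2 * p + 3) - 2 * t * c ρ p / ((2 * p + 3) * (2 * p + 4))) := by
    rw [intervalIntegral.integral_finsetSum (fun p _ => (mono_ii _ _ _ _).sub (mono_ii _ _ _ _))]
    refine Finset.sum_congr rfl (fun p _ => ?_)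
    rw [intervalIntegral.integral_sub (mono_ii _ _ _ _) (mono_ii _ _ _ _), mono_int, mono_int]
    have hp : (0:ℝ) ≤ p := Nat.cast_nonneg p
    have h3 : (2 * (p:ℝ) + 3) ≠ 0 := by positivity
    have h4 : (2 * (p:ℝ) + 4) ≠ 0 := by positivity
    have h5 : (2 * (p:ℝ) + 2 + 1) ≠ 0 := by positivity
    have h6 : (2 * (p:ℝ) + 3 + 1) ≠ 0 := by positivity
    push_cast
    field_simp
    ring
  have hDint : ∫ L in (0:ℝ)..1, ∑ p ∈ range 12, ∑ q ∈ range 12,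
      ((c ρ p * c ρ q) * L ^ (2 * p + 2 * q + 4) - (2 * c ρ p * c ρ q / (2 * q + 3)) * L ^ (2 * p + 2 * q + 5)
        + (c ρ p * c ρ q / (2 * p + 2 * q + 5)) * L ^ (2 * p + 2 * q + 5))
      = ∑ p ∈ range 12, ∑ q ∈ range 12,
          (c ρ p * c ρ q / (2 * p + 2 * q + 5) - 2 * c ρ p * c ρ q / ((2 * q + 3) * (2 * p + 2 * q + 6))
            + c ρ p * c ρ q / ((2 * p + 2 * q + 5) * (2 * p + 2 * q + 6))) := by
    rw [intervalIntegral.integral_finsetSum (fun p _ =>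
      (continuous_finsetSum _ (fun q _ => by fun_prop)).intervalIntegrable 0 1)]
    refine Finset.sum_congr rfl (fun p _ => ?_)
    rw [intervalIntegral.integral_finsetSum (fun q _ =>
      ((mono_ii _ _ _ _).sub (mono_ii _ _ _ _)).add (mono_ii _ _ _ _))]
    refine Finset.sum_congr rfl (fun q _ => ?_)
    rw [intervalIntegral.integral_add ((mono_ii _ _ _ _).sub (mono_ii _ _ _ _)) (mono_ii _ _ _ _),
      intervalIntegral.integral_sub (mono_ii _ _ _ _) (mono_ii _ _ _ _), mono_int, mono_int, mono_int]
    have hp : (0:ℝ) ≤ p := Nat.cast_nonneg p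
    have hq : (0:ℝ) ≤ q := Nat.cast_nonneg q
    have h3 : (2 * (q:ℝ) + 3) ≠ 0 := by positivity
    have h4 : (2 * (p:ℝ) + 2 * q + 5) ≠ 0 := by positivity
    have h5 : (2 * (p:ℝ) + 2 * q + 6) ≠ 0 := by positivity
    have h6 : (2 * (p:ℝ) + 2 * q + 4 + 1) ≠ 0 := by positivity
    have h7 : (2 * (p:ℝ) + 2 * q + 5 + 1) ≠ 0 := by positivity
    push_cast
    field_simp
    ring
  rw [intervalIntegral.integral_add (iC.add iS) iD, intervalIntegral.integral_add iC iS,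
    intervalIntegral.integral_const, hSint, hDint]
  simp

/-- `PJ` as the truncated double sum plus the tail allowance `8ρ²⁴/26!` (polynomial identity). -/
theorem PJ_eq (ρ : ℝ) : PJ ρ
    = (∑ p ∈ range 12, ∑ q ∈ range 12,
          (c ρ p * c ρ q / (2 * p + 2 * q + 5) - 2 * c ρ p * c ρ q / ((2 * q + 3) * (2 * p + 2 * q + 6))
            + c ρ p * c ρ q / ((2 * p + 2 * q + 5) * (2 * p + 2 * q + 6))))
      + 8 * ρ ^ 24 / (Nat.factorial 26 : ℝ) := by
  simp only [PJ, evenPoly, PJc, List.foldr, c, Finset.sum_range_succ, Finset.sum_range_zero]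
  norm_num [Nat.factorial_succ]
  ring

/-- Stage E, second half: the majorant of record for `J(ρ)/ρ⁴` holds on `[0,1]`. -/
theorem majorJ : MajorJ := by
  intro ρ hρ0 hρ1
  set t := ρ ^ 24 / (Nat.factorial 26 : ℝ) * 2 with ht
  -- inner bound, pointwise in σ
  have inner : ∀ σ ∈ Icc (0:ℝ) 1,
      (∫ u in (0:ℝ)..1, (Real.cosh (ρ * (1 - σ)) - Real.cosh (ρ * (max σ u - σ))) ^ 2) ≤ ρ ^ 4 * clf ρ t (1 - σ) := by
    intro σ hσ
    have mono : (∫ u in (0:ℝ)..1, (Real.cosh (ρ * (1 - σ)) - Real.cosh (ρ * (max σ u - σ))) ^ 2)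
        ≤ ∫ u in (0:ℝ)..1, ρ ^ 4 * ((∑ p ∈ range 12, c ρ p * w p (1 - σ) (max σ u - σ)) + t) ^ 2 := by
      refine intervalIntegral.integral_mono_on zero_le_one ?_ ?_ (fun u hu => ?_)
      · exact ((continuous_const.sub (Real.continuous_cosh.comp
          (continuous_const.mul ((continuous_const.max continuous_id).sub continuous_const)))).pow 2).intervalIntegrable 0 1
      · exact ((cont_inner ρ σ t).const_mul _ |>.intervalIntegrable 0 1)
      · have hv0 : 0 ≤ max σ u - σ := by have := le_max_left σ u; linarith
        have hvL : max σ u - σ ≤ 1 - σ := by have := max_le hσ.2 hu.2; linarith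
        have hL1 : 1 - σ ≤ 1 := by linarith [hσ.1]
        exact K_sq_le hρ0 hρ1 hv0 hvL hL1
    rw [intervalIntegral.integral_const_mul, inner_closed hσ.1 hσ.2 t] at mono
    exact mono
  -- outer integral
  have hK2 : Continuous (fun p : ℝ × ℝ =>
      (Real.cosh (ρ * (1 - p.1)) - Real.cosh (ρ * (max p.1 p.2 - p.1))) ^ 2) :=
    ((Real.continuous_cosh.comp (continuous_const.mul (continuous_const.sub continuous_fst))).sub
      (Real.continuous_cosh.comp (continuous_const.mul ((continuous_fst.max continuous_snd).sub continuous_fst)))).pow 2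
  have hclf : Continuous (clf ρ t) := by
    unfold clf
    refine ((?_ : Continuous _).sub ?_).add ?_
    · exact (continuous_const.add (continuous_finsetSum _ (fun p _ => by fun_prop))).pow 2
    · exact (continuous_const.mul (continuous_const.add (continuous_finsetSum _ (fun p _ => by fun_prop)))).mul
        (continuous_finsetSum _ (fun p _ => by fun_prop))
    · exact continuous_finsetSum _ (fun p _ => continuous_finsetSum _ (fun q _ => by fun_prop))
  have outer : Jfun ρ ≤ ∫ σ in (0:ℝ)..1, ρ ^ 4 * clf ρ t (1 - σ) := by
    unfold Jfun
    refine intervalIntegral.integral_mono_on zero_le_one ?_ ?_ inner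
    · exact (intervalIntegral.continuous_parametric_intervalIntegral_of_continuous' (μ := volume)
        (f := fun σ u : ℝ => (Real.cosh (ρ * (1 - σ)) - Real.cosh (ρ * (max σ u - σ))) ^ 2) hK2 0 1).intervalIntegrable 0 1
    · exact (continuous_const.mul (hclf.comp (continuous_const.sub continuous_id))).intervalIntegrable 0 1
  rw [intervalIntegral.integral_const_mul] at outer
  have subL : ∫ σ in (0:ℝ)..1, clf ρ t (1 - σ) = ∫ L in (0:ℝ)..1, clf ρ t L := by
    have := intervalIntegral.integral_comp_sub_left (a := 0) (b := 1) (clf ρ t) (1:ℝ)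
    simp only [sub_self, sub_zero] at this
    exact this
  rw [subL, integral_clf] at outer
  -- the algebra
  have key := PJ_eq ρ
  have hA : ∑ p ∈ range 12, c ρ p ≤ 1 := by
    calc ∑ p ∈ range 12, c ρ p ≤ ∑ p ∈ range 12, 1 / ((2 * p + 2).factorial : ℝ) :=
          Finset.sum_le_sum (fun p _ => c_le hρ0 hρ1 p)
      _ ≤ 1 := by norm_num [Finset.sum_range_succ, Nat.factorial_succ]
  have ht0 : 0 ≤ t := by positivity
  have ht1 : t ≤ 1 := by
    rw [ht]
    have : ρ ^ 24 ≤ 1 := pow_le_one₀ hρ0 hρ1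
    have h26 : (2:ℝ) ≤ (Nat.factorial 26 : ℝ) := by norm_num [Nat.factorial_succ]
    rw [div_mul_eq_mul_div, div_le_one (by positivity)]
    linarith
  have hS1 : ∑ p ∈ range 12, (2 * t * c ρ p / (2 * p + 3) - 2 * t * c ρ p / ((2 * p + 3) * (2 * p + 4)))
      ≤ 2 * t * ∑ p ∈ range 12, c ρ p := by
    rw [Finset.mul_sum]
    refine Finset.sum_le_sum (fun p _ => ?_)
    have hc := c_nonneg hρ0 p
    have h1 : 2 * t * c ρ p / (2 * p + 3) ≤ 2 * t * c ρ p :=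
      div_le_self (by positivity) (by have : (0:ℝ) ≤ p := Nat.cast_nonneg p; linarith)
    have h2 : 0 ≤ 2 * t * c ρ p / ((2 * p + 3) * (2 * p + 4)) := by positivity
    linarith
  have hfin : t ^ 2
      + ∑ p ∈ range 12, (2 * t * c ρ p / (2 * p + 3) - 2 * t * c ρ p / ((2 * p + 3) * (2 * p + 4)))
      + ∑ p ∈ range 12, ∑ q ∈ range 12,
          (c ρ p * c ρ q / (2 * p + 2 * q + 5) - 2 * c ρ p * c ρ q / ((2 * q + 3) * (2 * p + 2 * q + 6))
            + c ρ p * c ρ q / ((2 * p + 2 * q + 5) * (2 * p + 2 * q + 6))) ≤ PJ ρ := by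
    rw [key]
    have e8 : 8 * ρ ^ 24 / (Nat.factorial 26 : ℝ) = 4 * t := by rw [ht]; ring
    rw [e8]
    nlinarith [mul_le_mul_of_nonneg_left hA (by positivity : (0:ℝ) ≤ 2 * t),
      mul_le_mul_of_nonneg_left ht1 ht0]
  exact outer.trans (mul_le_mul_of_nonneg_left hfin (by positivity))

end MJ

end Summit.NavierStokesRegularity.TurbBounds.FSU1.Mode
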